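import Mathlib
import Summits.Ventures.PercRepro2.HCov
import Summits.Ventures.PercRepro2.BHKAvoid
import Summits.Ventures.PercRepro2.ExploreA3
import Summits.Ventures.PercRepro2.RootLeafUSigns
import Summits.Ventures.PercRepro2.RootLeafUHalf
import Summits.Ventures.PercRepro2.RootLeafUCore
import Summits.Ventures.PercRepro2.RootLeafUYA
import Summits.Ventures.PercRepro2.RootLeafUSepIndep

/-!
# (G4-u) on the separating class, part 2: `0 ≤ T2` and the class theorem (blind cell PercRepro2,
p4 g8; S3 (G4-u), proofs/P4-G8-SEP.md)
The root `a₁` is a leaf at the unmarked vertex `u`, and `a₂` separates `u` from `c` in `G − a₁`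
(`∀ ω, Conn ω u c → Conn ω u a₂`).  With the independence of the `c`-side (`RootLeafUSepIndep`):
* the `o ∈ L` half: `(YB) = d0 · P(a₂ ↔ c) · [2 Z P(Q, oL, bL) − P(Q, oL) P(Q, bL)] ≥ 0` by BHK06
  Thm 1.3 (`bhk_same_cluster_events`), so `T2oL = 2 ((YA) + (YB)) ≥ 0` with `YA_nonneg`
  (`Sep.T2oL_nonneg_of_sep`);
* the `o ∈ K` half: `T2oK = 2 P(PD, bL) [Z e0 + P(PD, oK)] − 2 (D + d0 Z) P(PD, oK, bL)`
  (`Sep.T2oK_sep_eq`, an identity once `T′ = ∅`), with `D · P(PD, oK, bL) ≤ P(PD, bL) · P(PD, oK)` by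
  the functional BHK06 Thm 1.3 (`bhk_same_cluster` with `F₁ = 1_{b ∈ ·}`, `F₂ = 1 − g`,
  `g(W) = P(a₂ ↔ o in G ∖ W, a₂ ↮ c)` antitone — `Sep.resOK`) and `P(PD, oK, bL) ≤ e0 · P(Q, bL)`
  (`g ≤ e0` pointwise), so `0 ≤ T2oK` (`Sep.T2oK_nonneg_of_sep`);
* **`Sep.HCov_root_leaf_u_of_sep`**: `0 ≤ T2 = T2oL + T2oK`, hence (HCOV) for the root-leaf
  instance from (HCOV) for the instance `a₁ := u` (`HCov_root_leaf_u_of`), on the separating class.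
-/

namespace Summit.Ventures.PercRepro2

open UnionCluster CovForm

namespace RootLeafU

namespace Sep

/-! ## The `o ∈ L` half on the separating class -/

section SepL

variable {V : Type*} {E : Type*} [Fintype E] [DecidableEq E] [Fintype V] [DecidableEq V]
  {R : Type*} [Field R] [LinearOrder R] [IsStrictOrderedRing R]

variable (p : E → R) (ends : E → Sym2 V) (o a₂ c b u : V)

/-- BHK06 Thm 1.3 (`bhk_same_cluster_events`) in the lane's vocabulary:
`P(Q, oL) · P(Q, bL) ≤ P(Q, oL, bL) · Z`. -/
lemma prob_Q_oL_mul_prob_Q_bL_le (hp : IsProbVec p) :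
    prob p (avoidAll ends a₂ {u} ∩ connEvent ends u o) *
        prob p (avoidAll ends a₂ {u} ∩ connEvent ends u b) ≤
      prob p (avoidAll ends a₂ {u} ∩ (connEvent ends u o ∩ connEvent ends u b)) *
        prob p (avoidAll ends a₂ {u}) := by
  have key := bhk_same_cluster_events p hp ends u a₂ (𝓤 := {W | o ∈ W}) (𝓥 := {W | b ∈ W})
    (fun _ _ h hW => h hW) (fun _ _ h hW => h hW)
  rw [ExploreA3.clusterInEvent_mem_eq, ExploreA3.clusterInEvent_mem_eq] at key
  have hQ : (connEvent ends u a₂)ᶜ = avoidAll ends a₂ {u} := by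
    rw [← avoidAll_singleton_eq ends u a₂, avoidAll_singleton_comm ends a₂ u]
  rw [hQ] at key
  have e1 : connEvent ends u o ∩ avoidAll ends a₂ {u} =
      avoidAll ends a₂ {u} ∩ connEvent ends u o := Set.inter_comm _ _
  have e2 : connEvent ends u b ∩ avoidAll ends a₂ {u} =
      avoidAll ends a₂ {u} ∩ connEvent ends u b := Set.inter_comm _ _
  have e3 : connEvent ends u o ∩ connEvent ends u b ∩ avoidAll ends a₂ {u} =
      avoidAll ends a₂ {u} ∩ (connEvent ends u o ∩ connEvent ends u b) := Set.inter_comm _ _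
  rw [e1, e2, e3] at key
  exact key

/-- **The `o ∈ L` half is non-negative on the separating class**: `(YB)` reduces to
`d0 · P(a₂ ↔ c) · [2 Z P(Q, oL, bL) − P(Q, oL) P(Q, bL)] ≥ 0` (BHK06 Thm 1.3), and `T2oL = 2((YA) + (YB))`
with `YA_nonneg`. -/
theorem T2oL_nonneg_of_sep (hp : IsProbVec p)
    (hsep : ∀ ω : Config E, Conn ends ω u c → Conn ends ω u a₂) (hua : u ≠ a₂) :
    0 ≤ T2oL p ends o a₂ c b u := by
  rw [T2oL_eq_YA_add_YB]
  have hYA := YA_nonneg p ends o a₂ c b u hp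
  have hTp := TEvent_swap_eq_empty ends a₂ c u hsep
  have hPDo := prob_PD_clusterIn_eq p ends a₂ c u hsep hua {W | o ∈ W}
  have hPDb := prob_PD_clusterIn_eq p ends a₂ c u hsep hua {W | b ∈ W}
  have hD := prob_PD_clusterIn_eq p ends a₂ c u hsep hua Set.univ
  have hTo := prob_T_clusterIn_eq p ends a₂ c u hsep hua {W | o ∈ W}
  have hTob := prob_T_clusterIn_eq p ends a₂ c u hsep hua ({W | o ∈ W} ∩ {W | b ∈ W})
  rw [ExploreA3.clusterInEvent_mem_eq] at hPDo hPDb hTo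
  rw [clusterInEvent_mem_inter_eq] at hTob
  rw [clusterInEvent_univ, Set.inter_univ, Set.inter_univ] at hD
  have hbhk := prob_Q_oL_mul_prob_Q_bL_le p ends o a₂ b u hp
  have hd0 : 0 ≤ prob p (avoidAll ends a₂ {c}) := prob_nonneg hp _
  have hhc : 0 ≤ prob p (connEvent ends a₂ c) := prob_nonneg hp _
  have hYB : 0 ≤ (prob p (avoidAll ends a₂ {c}) * prob p (avoidAll ends a₂ {u}) +
        prob p (PDEvent ends u a₂ c)) *
          prob p (TEvent ends u a₂ c ∩ (connEvent ends u o ∩ connEvent ends u b)) +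
        prob p (PDEvent ends u a₂ c ∩ connEvent ends u o) *
          (prob p (PDEvent ends u a₂ c ∩ connEvent ends u b) +
            prob p (TEvent ends a₂ u c ∩ connEvent ends u b)) -
        prob p (avoidAll ends a₂ {c}) * prob p (avoidAll ends a₂ {u} ∩ connEvent ends u b) *
          (prob p (PDEvent ends u a₂ c ∩ connEvent ends u o) +
            prob p (TEvent ends u a₂ c ∩ connEvent ends u o)) := by
    rw [hTp, Set.empty_inter, prob_empty, hPDo, hPDb, hD, hTo, hTob]
    have e : (prob p (avoidAll ends a₂ {c}) * prob p (avoidAll ends a₂ {u}) +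
          prob p (avoidAll ends a₂ {c}) * prob p (avoidAll ends a₂ {u})) *
            (prob p (connEvent ends a₂ c) *
              prob p (avoidAll ends a₂ {u} ∩ (connEvent ends u o ∩ connEvent ends u b))) +
          prob p (avoidAll ends a₂ {c}) * prob p (avoidAll ends a₂ {u} ∩ connEvent ends u o) *
            (prob p (avoidAll ends a₂ {c}) * prob p (avoidAll ends a₂ {u} ∩ connEvent ends u b) + 0) -
          prob p (avoidAll ends a₂ {c}) * prob p (avoidAll ends a₂ {u} ∩ connEvent ends u b) *
            (prob p (avoidAll ends a₂ {c}) * prob p (avoidAll ends a₂ {u} ∩ connEvent ends u o) +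
              prob p (connEvent ends a₂ c) * prob p (avoidAll ends a₂ {u} ∩ connEvent ends u o)) =
        prob p (avoidAll ends a₂ {c}) * prob p (connEvent ends a₂ c) *
          (2 * (prob p (avoidAll ends a₂ {u} ∩ (connEvent ends u o ∩ connEvent ends u b)) *
            prob p (avoidAll ends a₂ {u})) -
          prob p (avoidAll ends a₂ {u} ∩ connEvent ends u o) *
            prob p (avoidAll ends a₂ {u} ∩ connEvent ends u b)) := by ring
    rw [e]
    have hpos : 0 ≤ prob p (avoidAll ends a₂ {u} ∩ (connEvent ends u o ∩ connEvent ends u b)) *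
        prob p (avoidAll ends a₂ {u}) := mul_nonneg (prob_nonneg hp _) (prob_nonneg hp _)
    exact mul_nonneg (mul_nonneg hd0 hhc) (by linarith)
  linarith

end SepL

/-! ## The `o ∈ K` half on the separating class -/

section SepK

variable {V : Type*} {E : Type*} [Fintype E] [DecidableEq E] [Fintype V] [DecidableEq V]
  {R : Type*} [Field R] [LinearOrder R] [IsStrictOrderedRing R]

variable (p : E → R) (ends : E → Sym2 V) (o a₂ c b u : V)

omit [Fintype V] [DecidableEq V] in
/-- The residual functional of the `K`-event `{o ∈ K, c ∉ K}` with the `c`-part undeleted,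
`g(W) = P(a₂ ↔ o in G ∖ W, a₂ ↮ c)`, is antitone. -/
lemma resOK_anti (hp : IsProbVec p) : Antitone (fun W : Set V => prob p ({ω | Conn ends (delConfig ends W ω) a₂ o} ∩ (connEvent ends a₂ c)ᶜ)) := by
  intro W W' h
  refine prob_mono hp fun ω hω => ?_
  exact ⟨conn_mono (delConfig_anti h ω) hω.1, hω.2⟩

omit [Fintype V] [DecidableEq V] in
/-- `g ≤ e0 = P(a₂ ↮ c, a₂ ↔ o)`. -/
lemma resOK_le (hp : IsProbVec p) (W : Set V) :
    prob p ({ω | Conn ends (delConfig ends W ω) a₂ o} ∩ (connEvent ends a₂ c)ᶜ) ≤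
      prob p (avoidAll ends a₂ {c} ∩ connEvent ends a₂ o) := by
  rw [avoidAll_singleton_eq ends a₂ c]
  refine prob_mono hp fun ω hω => ?_
  exact ⟨hω.2, conn_mono (delConfig_le ends W ω) hω.1⟩

omit [Fintype V] [DecidableEq V] in
/-- `g ≤ 1`. -/
lemma resOK_le_one (hp : IsProbVec p) (W : Set V) :
    prob p ({ω | Conn ends (delConfig ends W ω) a₂ o} ∩ (connEvent ends a₂ c)ᶜ) ≤ 1 :=
  prob_le_one hp _

omit [DecidableEq V] [LinearOrder R] [IsStrictOrderedRing R] in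
/-- **Exploring `C(u)` with the `K`-event `{o ∈ K, c ∉ K}`** on the separating class:
`P(Q, C(u) ∈ 𝓤, o ∈ K, c ∉ K) = E[1_𝓤(C(u)) · g(C(u)) · 1_Q]` with `g = resOK` (by
`conn_delConfig_iff` the `c`-part of the residual is the global event). -/
theorem prob_Q_clusterIn_oK_eq (hsep : ∀ ω : Config E, Conn ends ω u c → Conn ends ω u a₂)
    (hua : u ≠ a₂) (𝓤 : Set (Set V)) :
    prob p (avoidAll ends a₂ {u} ∩ clusterInEvent ends u 𝓤 ∩
        (connEvent ends a₂ o ∩ (connEvent ends a₂ c)ᶜ)) =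
      expect p (fun ω => 𝓤.indicator 1 (cluster ends ω u) * prob p ({ω' | Conn ends (delConfig ends (cluster ends ω u) ω') a₂ o} ∩ (connEvent ends a₂ c)ᶜ) *
        (avoidAll ends a₂ {u}).indicator 1 ω) := by
  classical
  have ha2 : a₂ ∈ ({a₂} : Finset V) := by simp
  have tB := prob_clusterIn_inter_avoid_eq_expect p ends u a₂ ha2 𝓤 {W | o ∈ W ∧ c ∉ W}
  rw [clusterInEvent_mem_notMem_eq] at tB
  have e1 : clusterInEvent ends u 𝓤 ∩ (connEvent ends a₂ o ∩ (connEvent ends a₂ c)ᶜ) ∩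
      avoidAll ends u {a₂} =
      avoidAll ends a₂ {u} ∩ clusterInEvent ends u 𝓤 ∩
        (connEvent ends a₂ o ∩ (connEvent ends a₂ c)ᶜ) := by
    rw [avoidAll_singleton_comm ends a₂ u]
    ext ω
    simp only [Set.mem_inter_iff]
    tauto
  rw [e1] at tB
  rw [tB]
  simp only [avoidAll_singleton_comm ends a₂ u]
  congr 1
  funext ω
  by_cases hω : ω ∈ avoidAll ends a₂ {u}
  · have h₀ : ¬ Conn ends ω u a₂ := fun h => hω u (Finset.mem_singleton_self u) (conn_symm h)
    have hg : delClusterProb p ends a₂ {W | o ∈ W ∧ c ∉ W} (cluster ends ω u) =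
        prob p ({ω' | Conn ends (delConfig ends (cluster ends ω u) ω') a₂ o} ∩ (connEvent ends a₂ c)ᶜ) := by
      unfold delClusterProb
      congr 1
      ext ω'
      simp only [Set.mem_setOf_eq, mem_cluster, Set.mem_inter_iff, Set.mem_compl_iff,
        mem_connEvent]
      rw [conn_delConfig_iff hsep hua h₀ ω']
    rw [hg]
  · simp only [Set.indicator_of_notMem hω, mul_zero]

/-- **(a)**: `Z · P(Q, bL, oK, c ∉ K) ≤ P(Q, bL) · P(Q, oK, c ∉ K)` — the functional BHK06 Thm 1.3
(`bhk_same_cluster`) with `F₁ = 1_{b ∈ ·}` and `F₂ = 1 − g`. -/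
theorem Z_mul_prob_Q_bL_oK_le (hp : IsProbVec p)
    (hsep : ∀ ω : Config E, Conn ends ω u c → Conn ends ω u a₂) (hua : u ≠ a₂) :
    prob p (avoidAll ends a₂ {u}) *
        prob p (avoidAll ends a₂ {u} ∩ connEvent ends u b ∩
          (connEvent ends a₂ o ∩ (connEvent ends a₂ c)ᶜ)) ≤
      prob p (avoidAll ends a₂ {u} ∩ connEvent ends u b) *
        prob p (avoidAll ends a₂ {u} ∩ (connEvent ends a₂ o ∩ (connEvent ends a₂ c)ᶜ)) := by
  classical
  set g : Set V → R :=
    fun W => prob p ({ω | Conn ends (delConfig ends W ω) a₂ o} ∩ (connEvent ends a₂ c)ᶜ) with hg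
  have hg_anti : Antitone g := resOK_anti p ends o a₂ c hp
  have hg1 : ∀ W, g W ≤ 1 := resOK_le_one p ends o a₂ c hp
  have eUV := prob_Q_clusterIn_oK_eq p ends o a₂ c u hsep hua {W | b ∈ W}
  have eV := prob_Q_clusterIn_oK_eq p ends o a₂ c u hsep hua Set.univ
  simp only [Set.indicator_univ, Pi.one_apply, one_mul, clusterInEvent_univ, Set.inter_univ] at eV
  rw [ExploreA3.clusterInEvent_mem_eq] at eUV
  have hF₁ : Monotone ({W : Set V | b ∈ W}.indicator (1 : Set V → R)) := by
    intro W W' h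
    by_cases hW : W ∈ {W : Set V | b ∈ W}
    · simp [Set.indicator_of_mem hW, Set.indicator_of_mem (show W' ∈ {W : Set V | b ∈ W} from h hW)]
    · rw [Set.indicator_of_notMem hW]
      exact Set.indicator_apply_nonneg fun _ => zero_le_one
  have hF₂ : Monotone (fun W => 1 - g W) := fun W W' h => by
    simp only
    linarith [hg_anti h]
  have hF₁0 : ∀ W, 0 ≤ {W : Set V | b ∈ W}.indicator (1 : Set V → R) W :=
    fun W => Set.indicator_apply_nonneg fun _ => zero_le_one
  have hF₂0 : ∀ W, 0 ≤ 1 - g W := fun W => by linarith [hg1 W]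
  have key := bhk_same_cluster p hp ends u a₂ hF₁ hF₂ hF₁0 hF₂0
  have hQ : (connEvent ends u a₂)ᶜ = avoidAll ends a₂ {u} := by
    rw [← avoidAll_singleton_eq ends u a₂, avoidAll_singleton_comm ends a₂ u]
  simp only [hQ] at key
  have eU : expect p (fun ω => {W : Set V | b ∈ W}.indicator 1 (cluster ends ω u) *
      (avoidAll ends a₂ {u}).indicator 1 ω) =
      prob p (avoidAll ends a₂ {u} ∩ connEvent ends u b) := by
    rw [prob_eq_expect_indicator]
    unfold expect
    refine Finset.sum_congr rfl fun ω _ => ?_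
    congr 1
    rw [Set.inter_comm, indicator_inter_one]
    rfl
  have eR : prob p (avoidAll ends a₂ {u}) =
      expect p fun ω => (avoidAll ends a₂ {u}).indicator 1 ω :=
    prob_eq_expect_indicator p _
  have e2 : expect p (fun ω => (1 - g (cluster ends ω u)) * (avoidAll ends a₂ {u}).indicator 1 ω) =
      prob p (avoidAll ends a₂ {u}) -
        prob p (avoidAll ends a₂ {u} ∩ (connEvent ends a₂ o ∩ (connEvent ends a₂ c)ᶜ)) := by
    rw [eV, eR, ← expect_sub]
    congr 1
    funext ω
    simp only [Pi.sub_apply]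
    ring
  have e3 : expect p (fun ω => {W : Set V | b ∈ W}.indicator 1 (cluster ends ω u) *
      (1 - g (cluster ends ω u)) * (avoidAll ends a₂ {u}).indicator 1 ω) =
      prob p (avoidAll ends a₂ {u} ∩ connEvent ends u b) -
        prob p (avoidAll ends a₂ {u} ∩ connEvent ends u b ∩
          (connEvent ends a₂ o ∩ (connEvent ends a₂ c)ᶜ)) := by
    rw [eUV, ← eU, ← expect_sub]
    congr 1
    funext ω
    simp only [Pi.sub_apply]
    ring
  rw [eU, e2, e3] at key
  nlinarith [key]

omit [DecidableEq V] in
/-- **(b)**: `P(Q, bL, oK, c ∉ K) ≤ e0 · P(Q, bL)` (`g ≤ e0` pointwise). -/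
theorem prob_Q_bL_oK_le (hp : IsProbVec p)
    (hsep : ∀ ω : Config E, Conn ends ω u c → Conn ends ω u a₂) (hua : u ≠ a₂) :
    prob p (avoidAll ends a₂ {u} ∩ connEvent ends u b ∩
        (connEvent ends a₂ o ∩ (connEvent ends a₂ c)ᶜ)) ≤
      prob p (avoidAll ends a₂ {c} ∩ connEvent ends a₂ o) *
        prob p (avoidAll ends a₂ {u} ∩ connEvent ends u b) := by
  classical
  have eUV := prob_Q_clusterIn_oK_eq p ends o a₂ c u hsep hua {W | b ∈ W}
  rw [ExploreA3.clusterInEvent_mem_eq] at eUV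
  rw [eUV]
  have eU : prob p (avoidAll ends a₂ {u} ∩ connEvent ends u b) =
      expect p (fun ω => {W : Set V | b ∈ W}.indicator 1 (cluster ends ω u) *
        (avoidAll ends a₂ {u}).indicator 1 ω) := by
    rw [prob_eq_expect_indicator]
    unfold expect
    refine Finset.sum_congr rfl fun ω _ => ?_
    congr 1
    rw [Set.inter_comm, indicator_inter_one]
    rfl
  rw [eU, ← expect_const_mul]
  refine expect_mono hp fun ω => ?_
  have h1 := resOK_le p ends o a₂ c hp (cluster ends ω u)
  have h2 : (0 : R) ≤ ({W : Set V | b ∈ W}).indicator 1 (cluster ends ω u) :=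
    Set.indicator_apply_nonneg fun _ => zero_le_one
  have h3 : (0 : R) ≤ (avoidAll ends a₂ {u}).indicator 1 ω :=
    Set.indicator_apply_nonneg fun _ => zero_le_one
  calc ({W : Set V | b ∈ W}).indicator 1 (cluster ends ω u) * prob p ({ω' | Conn ends (delConfig ends (cluster ends ω u) ω') a₂ o} ∩ (connEvent ends a₂ c)ᶜ) *
        (avoidAll ends a₂ {u}).indicator 1 ω
      ≤ ({W : Set V | b ∈ W}).indicator 1 (cluster ends ω u) *
          prob p (avoidAll ends a₂ {c} ∩ connEvent ends a₂ o) *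
          (avoidAll ends a₂ {u}).indicator 1 ω :=
        mul_le_mul_of_nonneg_right (mul_le_mul_of_nonneg_left h1 h2) h3
    _ = prob p (avoidAll ends a₂ {c} ∩ connEvent ends a₂ o) *
          (({W : Set V | b ∈ W}).indicator 1 (cluster ends ω u) *
            (avoidAll ends a₂ {u}).indicator 1 ω) := by ring

omit [Fintype V] in
/-- **The `o ∈ K` half on the separating class** (an identity in the pattern masses once
`T′ = ∅`): `T2oK = 2 P(PD, bL) [Z e0 + P(PD, oK)] − 2 (D + d0 Z) P(PD, oK, bL)`. -/
theorem T2oK_sep_eq (hsep : ∀ ω : Config E, Conn ends ω u c → Conn ends ω u a₂) :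
    T2oK p ends o a₂ c b u =
      2 * prob p (PDEvent ends u a₂ c ∩ connEvent ends u b) *
          (prob p (avoidAll ends a₂ {u}) * prob p (avoidAll ends a₂ {c} ∩ connEvent ends a₂ o) +
            prob p (PDEvent ends u a₂ c ∩ connEvent ends a₂ o)) -
        2 * (prob p (PDEvent ends u a₂ c) + prob p (avoidAll ends a₂ {c}) * prob p (avoidAll ends a₂ {u})) *
          prob p (PDEvent ends u a₂ c ∩ (connEvent ends a₂ o ∩ connEvent ends u b)) := by
  have hTp := TEvent_swap_eq_empty ends a₂ c u hsep
  have hZ := Qsplit_univ p ends u a₂ c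
  have hbK := Qsplit p ends u a₂ c (connEvent ends a₂ b)
  have hbL := Qsplit p ends u a₂ c (connEvent ends u b)
  have hgap := gap_eq_Q p ends u a₂ b
  unfold T2oK Ee EQb3 PDb EQ3
  rw [prob_univ, hgap, hZ, hbK, hbL]
  simp only [hTp, Set.empty_inter, prob_empty]
  ring

/-- **The `o ∈ K` half is non-negative on the separating class.** -/
theorem T2oK_nonneg_of_sep (hp : IsProbVec p)
    (hsep : ∀ ω : Config E, Conn ends ω u c → Conn ends ω u a₂) (hua : u ≠ a₂) :
    0 ≤ T2oK p ends o a₂ c b u := by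
  rw [T2oK_sep_eq p ends o a₂ c b u hsep]
  have hPDb := prob_PD_clusterIn_eq p ends a₂ c u hsep hua {W | b ∈ W}
  rw [ExploreA3.clusterInEvent_mem_eq] at hPDb
  have hD := prob_PD_clusterIn_eq p ends a₂ c u hsep hua Set.univ
  rw [clusterInEvent_univ, Set.inter_univ, Set.inter_univ] at hD
  have hA : prob p (PDEvent ends u a₂ c ∩ connEvent ends a₂ o) =
      prob p (avoidAll ends a₂ {u} ∩ (connEvent ends a₂ o ∩ (connEvent ends a₂ c)ᶜ)) := by
    rw [PDEvent_eq ends a₂ c u hsep]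
    congr 1
    ext ω
    simp only [Set.mem_inter_iff, Set.mem_compl_iff]
    tauto
  have hB : prob p (PDEvent ends u a₂ c ∩ (connEvent ends a₂ o ∩ connEvent ends u b)) =
      prob p (avoidAll ends a₂ {u} ∩ connEvent ends u b ∩
        (connEvent ends a₂ o ∩ (connEvent ends a₂ c)ᶜ)) := by
    rw [PDEvent_eq ends a₂ c u hsep]
    congr 1
    ext ω
    simp only [Set.mem_inter_iff, Set.mem_compl_iff]
    tauto
  rw [hPDb, hD, hA, hB]
  have ha := Z_mul_prob_Q_bL_oK_le p ends o a₂ c b u hp hsep hua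
  have hb := prob_Q_bL_oK_le p ends o a₂ c b u hp hsep hua
  have hd0 : 0 ≤ prob p (avoidAll ends a₂ {c}) := prob_nonneg hp _
  have hZ : 0 ≤ prob p (avoidAll ends a₂ {u}) := prob_nonneg hp _
  have h1 : 0 ≤ prob p (avoidAll ends a₂ {u}) *
      (prob p (avoidAll ends a₂ {c} ∩ connEvent ends a₂ o) *
          prob p (avoidAll ends a₂ {u} ∩ connEvent ends u b) -
        prob p (avoidAll ends a₂ {u} ∩ connEvent ends u b ∩
          (connEvent ends a₂ o ∩ (connEvent ends a₂ c)ᶜ))) :=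
    mul_nonneg hZ (by linarith)
  have h2 : 0 ≤ prob p (avoidAll ends a₂ {u} ∩ connEvent ends u b) *
        prob p (avoidAll ends a₂ {u} ∩ (connEvent ends a₂ o ∩ (connEvent ends a₂ c)ᶜ)) -
      prob p (avoidAll ends a₂ {u}) *
        prob p (avoidAll ends a₂ {u} ∩ connEvent ends u b ∩
          (connEvent ends a₂ o ∩ (connEvent ends a₂ c)ᶜ)) := by linarith
  nlinarith [mul_nonneg hd0 h1, mul_nonneg hd0 h2]

end SepK

/-! ## The class theorem -/

section SepMain

variable {V : Type*} {E : Type*} [Fintype E] [DecidableEq E] [Fintype V] [DecidableEq V]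
  {R : Type*} [Field R] [LinearOrder R] [IsStrictOrderedRing R]

variable (p : E → R) (ends : E → Sym2 V) (o a₂ c b u : V)

/-- **`0 ≤ T2` on the separating class.** -/
theorem T2_nonneg_of_sep (hp : IsProbVec p)
    (hsep : ∀ ω : Config E, Conn ends ω u c → Conn ends ω u a₂) (hua : u ≠ a₂) :
    0 ≤ T2 p ends o a₂ c b u :=
  T2_nonneg_of_halves p ends o a₂ c b u (T2oL_nonneg_of_sep p ends o a₂ c b u hp hsep hua)
    (T2oK_nonneg_of_sep p ends o a₂ c b u hp hsep hua)

/-- **(G4-u) on the separating class**: for the root `a₁` a leaf at the unmarked vertex `u`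
(edge `f`), if `a₂` separates `u` from `c` (every configuration with `u ↔ c` has `u ↔ a₂`; as `a₁` is
a leaf this is separation in `G − a₁`), then (HCOV) for the root-leaf instance follows from (HCOV)
for the instance `a₁ := u`. -/
theorem HCov_root_leaf_u_of_sep (hp : IsProbVec p) {f : E} {a₁ : V} (hf : ends f = s(a₁, u))
    (hleaf : ∀ e, a₁ ∈ ends e → e = f) (h1u : a₁ ≠ u) (h12 : a₁ ≠ a₂) (h1c : a₁ ≠ c)
    (h1o : a₁ ≠ o) (h1b : a₁ ≠ b) (hua : u ≠ a₂)
    (hsep : ∀ ω : Config E, Conn ends ω u c → Conn ends ω u a₂)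
    (h3 : HCov p ends o u a₂ c b) : HCov p ends o a₁ a₂ c b :=
  HCov_root_leaf_u_of p ends hp hf hleaf h1u h12 h1c h1o h1b
    (T2_nonneg_of_sep p ends o a₂ c b u hp hsep hua) h3

end SepMain

end Sep

end RootLeafU

end Summit.Ventures.PercRepro2
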